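import Summits.QuantumFields.YangMills.Theorems.ParabolicTrajectoryLatticeGapOnTrajectoryStubLargeFieldSparseOfChessboard
import HarnessLib

/-!
# Crux `NonSimplyConnectedLatticeGap` (stmt-QuantumFields-16405), line `Sketch`:
# stub (LFS) `stub_largeFieldSparse_explicit` — large-field sparseness from the four-direction
# tilt chessboard, with the explicit torus threshold `S₀ = 1`

Registered stub (LFS) of the line skeleton, `--supports stmt-QuantumFields-16405`. GIVEN the
four-direction chessboard estimate (C) for exponential tilt functionals of one plaquette orientation
class `o` on the odd four-torus `(ℤ/(2S+1))⁴`,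
`Φ(c)^{(2S+1)⁴} ≤ ∏_y Φ(const (c y))`, `Φ(c) = E_β exp(−∑ₓ c(x) Re tr ρ(U_{(x,o)}))`, `0 ≤ c ≤ β`,
we prove large-field sparseness of Wilson's torus measures for every faithful unitary lattice
representation `r` of a compact group `G`: for every `ε₀ > 0` there are `c > 0`, `b₀` with
`μ_{β,2S+1}(∀ p ∈ X, N − Re tr r(U_p) ≥ ε₀) ≤ exp(−c β |X|)` for all `β ≥ b₀`, ALL `S ≥ 1` and all
plaquette sets `X`.

This is the landed Chebyshev assembly
`LatticeGapOnTrajectory.SparseDefectOrbitWindow.stub_largeFieldSparse_of_chessboard` (crux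
`LatticeGapOnTrajectory`, line `sparse-defect-orbit-window`) with its torus threshold `S₀` exposed
as `1`: that proof already chooses `S₀ = 1`, and the argument below is the same one.

Proof (Bałaban's large-field suppression in its classical chessboard form).
* Pigeonhole: one orientation class `o` carries `|X_o| ≥ |X| / 6` of the plaquettes of `X`
  (`X_o = {x | (x, o) ∈ X}`); the event only shrinks the measure when restricted to `X_o`.
* Chebyshev with tilt `β`: `μ(∀ x ∈ X_o, ε₀ ≤ N − Re tr) ≤ e^{β(N−ε₀)|X_o|} Φ(β·1_{X_o})`.
* Chessboard (C): `Φ(β 1_{X_o})^{L⁴} ≤ Φ(const β)^{|X_o|}` (`Φ(const 0) = 1`).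
* Switching one orientation class off costs at most the free energy:
  `Φ(const β) = Z⁻¹ ∫ e^{−βS − β∑_{P_o} Re tr} dHaar ≤ e^{−βN L⁴} / Z_L(β)` (`|Re tr| ≤ N`), and the
  landed crude free-energy bound `Z_L(β) ≥ e^{−48βδ²L⁴} (C₁δ^D)^{4L⁴}`
  (`FemtoCurvatureTwoPoint.DoublingOfRV.exp_mul_pow_le_partitionFunction_toReal`) with
  `48 δ² ≤ ε₀ / 2`.
* Taking `L⁴`-th roots and `β ≥ b₀ = max 0 (−4 log κ / ε₀)`, `κ = (C₁δ^D)^4`, gives the rate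
  `c = ε₀ / (4 K₀)`, `K₀ = 6` the number of coordinate planes.
-/

set_option autoImplicit false

noncomputable section

namespace Summit.QuantumFields.YangMills.Theorems.NonSimplyConnectedLatticeGap

open scoped BigOperators ENNReal
open MeasureTheory Literature.MathematicalPhysics.QuantumFieldTheory
open Summit.QuantumFields.YangMills.Theorems.FreeEnergyLogCoefficient
open Summit.QuantumFields.YangMills.Theorems.FemtoCurvatureTwoPoint.DoublingOfRV
open Summit.QuantumFields.YangMills.Cruxes.LatticeGapOnTrajectory.SparseDefectOrbitWindow

/-- **(LFS) stub_largeFieldSparse_explicit** — CHEBYSHEV ASSEMBLY WITH EXPLICIT TORUS THRESHOLD: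
the four-direction tilt chessboard (C) implies large-field sparseness in the unfolded form of
`LargeFieldSparse r` for every faithful unitary lattice representation `r` of a compact `G`, on
every odd torus `(ℤ/(2S+1))⁴` with `S ≥ 1`. Route: pigeonhole to the plane `o` with
`|{x | (x,o) ∈ X}| ≥ |X|/6` and monotonicity of the event; Chebyshev with tilt `β`; the chessboard
(C) with the profile `β·1_{X_o}`; the free-energy cost `exp(−βN L⁴)/Z_L(β)` of switching the class
off; the landed crude lower bound `Z_L(β) ≥ e^{−48βδ²L⁴}(C₁δ^D)^{4L⁴}` with `48 δ² ≤ ε₀/2`;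
constants `b₀ = max 0 (−4 log κ / ε₀)`, `κ = (C₁δ^D)^4`, `c = ε₀/(4·6)`. -/
theorem stub_largeFieldSparse_explicit : (∀ (S N : ℕ) (G : Type) [Group G] [TopologicalSpace G] [IsTopologicalGroup G] [CompactSpace G] [MeasurableSpace G] [BorelSpace G] (ρ : G →* Matrix (Fin N) (Fin N) ℂ), 1 ≤ S → Continuous ρ → ∀ (β : ℝ), 0 ≤ β → ∀ (o : {q : Fin 4 × Fin 4 // q.1 < q.2}) (c : Literature.MathematicalPhysics.QuantumFieldTheory.Site 4 (2 * S + 1) → ℝ), (∀ x, 0 ≤ c x) → (∀ x, c x ≤ β) → (∫ U, Real.exp (-∑ x : Literature.MathematicalPhysics.QuantumFieldTheory.Site 4 (2 * S + 1), c x * Literature.MathematicalPhysics.QuantumFieldTheory.WilsonRP.plaqRe ρ U (x, o)) ∂(Literature.MathematicalPhysics.QuantumFieldTheory.wilsonMeasure ρ β : MeasureTheory.Measure (Literature.MathematicalPhysics.QuantumFieldTheory.GaugeConfig 4 (2 * S + 1) G))) ^ ((2 * S + 1) ^ 4) ≤ ∏ y : Literature.MathematicalPhysics.QuantumFieldTheory.Site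 4 (2 * S + 1), ∫ U, Real.exp (-∑ x : Literature.MathematicalPhysics.QuantumFieldTheory.Site 4 (2 * S + 1), c y * Literature.MathematicalPhysics.QuantumFieldTheory.WilsonRP.plaqRe ρ U (x, o)) ∂(Literature.MathematicalPhysics.QuantumFieldTheory.wilsonMeasure ρ β : MeasureTheory.Measure (Literature.MathematicalPhysics.QuantumFieldTheory.GaugeConfig 4 (2 * S + 1) G))) → ∀ (G : Type) [Group G] [TopologicalSpace G] [IsTopologicalGroup G] [CompactSpace G] [MeasurableSpace G] [BorelSpace G] (r : Literature.MathematicalPhysics.QuantumFieldTheory.LatticeRep G) (ε₀ : ℝ), 0 < ε₀ → ∃ (c b₀ : ℝ), 0 < c ∧ ∀ β : ℝ, b₀ ≤ β → ∀ S : ℕ, 1 ≤ S → ∀ X : Finset (Literature.MathematicalPhysics.QuantumFieldTheory.Plaquette 4 (2 * S + 1)), (Literature.MathematicalPhysics.QuantumFieldTheory.wilsonMeasure r.ρ β : MeasureTheory.Measure (Literature.MathematicalPhysics.QuantumFieldTheory.GaugeConfig 4 (2 * S + 1) G)) {U | ∀ p ∈ X, ε₀ ≤ (r.N : ℝ) -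 (r.ρ (Literature.MathematicalPhysics.QuantumFieldTheory.plaquetteHolonomy U p.1 p.2.1.1 p.2.1.2)).trace.re} ≤ ENNReal.ofReal (Real.exp (-(c * β * X.card))) := by
  intro hC G _ _ _ _ _ _ r ε₀ hε₀
  -- ### constants
  obtain ⟨C₁, hC₁, hZ⟩ := exp_mul_pow_le_partitionFunction_toReal r
  haveI hne : Nonempty {q : Fin 4 × Fin 4 // q.1 < q.2} := ⟨⟨(0, 1), by decide⟩⟩
  have hK₀ : (0 : ℝ) < Fintype.card {q : Fin 4 × Fin 4 // q.1 < q.2} := by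
    exact_mod_cast Fintype.card_pos
  obtain ⟨δ, hδpos, hδ1, hδε⟩ : ∃ δ : ℝ, 0 < δ ∧ δ ≤ 1 ∧ 48 * δ ^ 2 ≤ ε₀ / 2 := by
    have h96 : 0 < ε₀ / 96 := div_pos hε₀ (by norm_num)
    refine ⟨min 1 (Real.sqrt (ε₀ / 96)), lt_min one_pos (Real.sqrt_pos.2 h96), min_le_left _ _, ?_⟩
    have h1 : min 1 (Real.sqrt (ε₀ / 96)) ^ 2 ≤ Real.sqrt (ε₀ / 96) ^ 2 :=
      pow_le_pow_left₀ (le_min zero_le_one (Real.sqrt_nonneg _)) (min_le_right _ _) 2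
    rw [Real.sq_sqrt h96.le] at h1
    linarith
  have hκpos : 0 < (C₁ * δ ^ dimE r.ρ) ^ 4 := by positivity
  set κ : ℝ := (C₁ * δ ^ dimE r.ρ) ^ 4
  refine ⟨ε₀ / (4 * Fintype.card {q : Fin 4 × Fin 4 // q.1 < q.2}),
    max 0 (-4 * Real.log κ / ε₀), div_pos hε₀ (mul_pos zero_lt_four hK₀), ?_⟩
  intro β hβ S hS X
  have hβ0 : 0 ≤ β := le_trans (le_max_left _ _) hβ
  have hκβ : Real.exp (-(β * ε₀ / 4)) ≤ κ := by
    have h := le_trans (le_max_right _ _) hβ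
    rw [div_le_iff₀ hε₀] at h
    calc Real.exp (-(β * ε₀ / 4)) ≤ Real.exp (Real.log κ) := Real.exp_le_exp.2 (by linarith)
      _ = κ := Real.exp_log hκpos
  -- ### Step 1: pigeonhole to one orientation class
  obtain ⟨o, -, ho⟩ := Finset.exists_le_card_fiber_of_nsmul_le_card_of_maps_to
    (s := X) (t := (Finset.univ : Finset {q : Fin 4 × Fin 4 // q.1 < q.2}))
    (f := fun p : Plaquette 4 (2 * S + 1) => p.2)
    (b := (X.card : ℝ) / Fintype.card {q : Fin 4 × Fin 4 // q.1 < q.2})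
    (fun p _ => Finset.mem_univ _) Finset.univ_nonempty
    (by rw [Finset.card_univ, nsmul_eq_mul, mul_div_cancel₀ _ hK₀.ne'])
  set Xs : Finset (Site 4 (2 * S + 1)) := (X.filter fun p => p.2 = o).image Prod.fst with hXsdef
  have hXs_card : Xs.card = (X.filter fun p => p.2 = o).card := by
    refine Finset.card_image_of_injOn ?_
    rintro ⟨x, q⟩ hp ⟨x', q'⟩ hp' (h : x = x')
    simp only [Finset.mem_coe, Finset.mem_filter] at hp hp'
    rw [Prod.mk.injEq]
    exact ⟨h, hp.2.trans hp'.2.symm⟩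
  have hmemXs : ∀ x ∈ Xs, (x, o) ∈ X := by
    intro x hx
    rw [hXsdef, Finset.mem_image] at hx
    obtain ⟨p, hp, hpx⟩ := hx
    rw [Finset.mem_filter] at hp
    have hpxo : p = (x, o) := Prod.ext hpx hp.2
    rw [← hpxo]
    exact hp.1
  have hn : (X.card : ℝ) / Fintype.card {q : Fin 4 × Fin 4 // q.1 < q.2} ≤ Xs.card := by
    rw [hXs_card]; exact ho
  -- ### the measure and the tilt profile `β · 1_{X_o}`
  haveI := isProbabilityMeasure_wilsonMeasure (d := 4) (L := 2 * S + 1) r.ρ r.continuous β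
  set μ : Measure (GaugeConfig 4 (2 * S + 1) G) := wilsonMeasure r.ρ β
  obtain ⟨e, hedef⟩ : ∃ e : Site 4 (2 * S + 1) → ℝ, e = fun x => if x ∈ Xs then β else 0 :=
    ⟨_, rfl⟩
  have he0 : ∀ x, 0 ≤ e x := fun x => by
    rw [hedef]; dsimp only; split_ifs; exacts [hβ0, le_rfl]
  have heβ : ∀ x, e x ≤ β := fun x => by
    rw [hedef]; dsimp only; split_ifs; exacts [le_rfl, hβ0]
  set Φe : ℝ := ∫ U, Real.exp (-∑ x : Site 4 (2 * S + 1), e x * WilsonRP.plaqRe r.ρ U (x, o)) ∂μ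
  set Φβ : ℝ := ∫ U, Real.exp (-∑ x : Site 4 (2 * S + 1), β * WilsonRP.plaqRe r.ρ U (x, o)) ∂μ
    with hΦβdef
  have hΦe0 : 0 ≤ Φe := integral_nonneg fun U => (Real.exp_pos _).le
  have hΦβ0 : 0 ≤ Φβ := integral_nonneg fun U => (Real.exp_pos _).le
  -- ### Steps 2–3: monotonicity and Chebyshev with tilt `β`
  have hcheb : μ {U | ∀ p ∈ X, ε₀ ≤ (r.N : ℝ) -
      (r.ρ (plaquetteHolonomy U p.1 p.2.1.1 p.2.1.2)).trace.re} ≤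
      ENNReal.ofReal (Real.exp (β * (Xs.card * (r.N - ε₀))) * Φe) := by
    have hg_int : Integrable (fun U => Real.exp (β * (Xs.card * (r.N - ε₀))) *
        Real.exp (-∑ x : Site 4 (2 * S + 1), e x * WilsonRP.plaqRe r.ρ U (x, o))) μ :=
      (integrable_exp_neg_tilt r.ρ r.continuous o e μ).const_mul _
    have hmarkov := mul_meas_ge_le_integral_of_nonneg (ae_of_all _ fun U => by positivity) hg_int 1
    rw [one_mul, integral_const_mul] at hmarkov
    have hsub : {U : GaugeConfig 4 (2 * S + 1) G | ∀ p ∈ X, ε₀ ≤ (r.N : ℝ) -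
        (r.ρ (plaquetteHolonomy U p.1 p.2.1.1 p.2.1.2)).trace.re} ⊆
        {U | 1 ≤ Real.exp (β * (Xs.card * (r.N - ε₀))) *
          Real.exp (-∑ x : Site 4 (2 * S + 1), e x * WilsonRP.plaqRe r.ρ U (x, o))} := by
      intro U hU
      simp only [Set.mem_setOf_eq] at hU ⊢
      rw [← Real.exp_add]
      refine Real.one_le_exp ?_
      have hsum : ∑ x : Site 4 (2 * S + 1), e x * WilsonRP.plaqRe r.ρ U (x, o) =
          β * ∑ x ∈ Xs, WilsonRP.plaqRe r.ρ U (x, o) := by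
        rw [hedef]
        simp only [ite_mul, zero_mul, Finset.sum_ite_mem_eq]
        rw [Finset.mul_sum]
      have hle : ∑ x ∈ Xs, WilsonRP.plaqRe r.ρ U (x, o) ≤ ∑ _x ∈ Xs, ((r.N : ℝ) - ε₀) :=
        Finset.sum_le_sum fun x hx => by
          have h' : ε₀ ≤ (r.N : ℝ) - WilsonRP.plaqRe r.ρ U (x, o) := hU (x, o) (hmemXs x hx)
          linarith
      rw [Finset.sum_const, nsmul_eq_mul] at hle
      rw [hsum]
      have := mul_le_mul_of_nonneg_left hle hβ0
      linarith
    calc μ _ ≤ μ _ := measure_mono hsub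
      _ = ENNReal.ofReal (μ.real _) := (ofReal_measureReal (measure_ne_top _ _)).symm
      _ ≤ _ := ENNReal.ofReal_le_ofReal hmarkov
  -- ### Step 4: the chessboard estimate for the profile `β · 1_{X_o}`
  have hCe := hC S r.N G r.ρ hS r.continuous β hβ0 o e he0 heβ
  have hprod : (∏ y : Site 4 (2 * S + 1), ∫ U, Real.exp (-∑ x : Site 4 (2 * S + 1),
      e y * WilsonRP.plaqRe r.ρ U (x, o)) ∂μ) = Φβ ^ Xs.card := by
    have hy : ∀ y : Site 4 (2 * S + 1), (∫ U, Real.exp (-∑ x : Site 4 (2 * S + 1),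
        e y * WilsonRP.plaqRe r.ρ U (x, o)) ∂μ) = if y ∈ Xs then Φβ else 1 := by
      intro y
      by_cases hyX : y ∈ Xs
      · rw [if_pos hyX, hedef, hΦβdef]
        simp only [if_pos hyX]
      · rw [if_neg hyX, hedef]
        simp only [if_neg hyX, zero_mul, Finset.sum_const_zero, neg_zero, Real.exp_zero]
        simp
    simp_rw [hy]
    rw [Finset.prod_ite_mem_eq, Finset.prod_const]
  rw [hprod] at hCe
  -- ### Step 5: switching the class off costs at most the free energy
  have hcardS : Fintype.card (Site 4 (2 * S + 1)) = (2 * S + 1) ^ 4 := by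
    rw [Fintype.card_fun, ZMod.card, Fintype.card_fin]
  set M : ℕ := (2 * S + 1) ^ 4 with hMdef
  have hM0 : M ≠ 0 := pow_ne_zero _ (Nat.succ_ne_zero _)
  have hZlpos : 0 < Real.exp (-(48 * β * δ ^ 2)) * κ := mul_pos (Real.exp_pos _) hκpos
  set Zl : ℝ := Real.exp (-(48 * β * δ ^ 2)) * κ with hZldef
  have hZlM : Zl ^ M ≤ (partitionFunction (d := 4) (L := 2 * S + 1) r.ρ β).toReal := by
    have hexp : Real.exp (-(β * (8 * δ ^ 2 * ((6 * M : ℕ) : ℝ)))) =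
        Real.exp (-(48 * β * δ ^ 2)) ^ M := by
      rw [← Real.exp_nat_mul]; congr 1; push_cast; ring
    have h := hZ (2 * S + 1) β δ hβ0 hδpos hδ1
    rw [card_edge, card_plaquette, ← hMdef, hexp, pow_mul, ← mul_pow] at h
    exact h
  have hA0 : 0 ≤ Real.exp (-(β * r.N)) / Zl := div_nonneg (Real.exp_pos _).le hZlpos.le
  set A : ℝ := Real.exp (-(β * r.N)) / Zl with hAdef
  have hΦβ : Φβ ≤ A ^ M := by
    have h := integral_exp_class_le_div r.ρ r.continuous hβ0 o (pow_pos hZlpos M) hZlM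
    rw [hcardS] at h
    refine h.trans (le_of_eq ?_)
    rw [hAdef, div_pow, ← Real.exp_nat_mul,
      show (M : ℝ) * -(β * r.N) = -(β * r.N * M) by ring]
  -- ### Step 6: `L⁴`-th roots and the final arithmetic
  have h1 : Φe ^ M ≤ (A ^ Xs.card) ^ M :=
    calc Φe ^ M ≤ Φβ ^ Xs.card := hCe
      _ ≤ (A ^ M) ^ Xs.card := pow_le_pow_left₀ hΦβ0 hΦβ _
      _ = (A ^ Xs.card) ^ M := by rw [← pow_mul, ← pow_mul, mul_comm]
  have h2 : Φe ≤ A ^ Xs.card := (pow_le_pow_iff_left₀ hΦe0 (pow_nonneg hA0 _) hM0).1 h1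
  have hbase : Real.exp (β * (r.N - ε₀)) * A ≤ Real.exp (-(β * ε₀ / 4)) := by
    rw [hAdef, mul_div_assoc', div_le_iff₀ hZlpos, ← Real.exp_add, hZldef]
    have hβδ := mul_le_mul_of_nonneg_left hδε hβ0
    calc Real.exp (β * (r.N - ε₀) + -(β * r.N))
        ≤ Real.exp (-(β * ε₀ / 4) + -(48 * β * δ ^ 2) + -(β * ε₀ / 4)) :=
          Real.exp_le_exp.2 (by linarith)
      _ = Real.exp (-(β * ε₀ / 4)) * (Real.exp (-(48 * β * δ ^ 2)) * Real.exp (-(β * ε₀ / 4))) := by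
          rw [Real.exp_add, Real.exp_add]; ring
      _ ≤ Real.exp (-(β * ε₀ / 4)) * (Real.exp (-(48 * β * δ ^ 2)) * κ) := by gcongr
  have h3 : Real.exp (β * (Xs.card * (r.N - ε₀))) * Φe ≤
      Real.exp (-(ε₀ / (4 * Fintype.card {q : Fin 4 × Fin 4 // q.1 < q.2}) * β * X.card)) := by
    have hpos : 0 ≤ Real.exp (β * (r.N - ε₀)) * A := mul_nonneg (Real.exp_pos _).le hA0
    calc Real.exp (β * (Xs.card * (r.N - ε₀))) * Φe
        ≤ Real.exp (β * (Xs.card * (r.N - ε₀))) * A ^ Xs.card :=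
          mul_le_mul_of_nonneg_left h2 (Real.exp_pos _).le
      _ = (Real.exp (β * (r.N - ε₀)) * A) ^ Xs.card := by
          rw [show β * (Xs.card * (r.N - ε₀)) = (Xs.card : ℝ) * (β * (r.N - ε₀)) by ring,
            Real.exp_nat_mul, mul_pow]
      _ ≤ Real.exp (-(β * ε₀ / 4)) ^ Xs.card := pow_le_pow_left₀ hpos hbase _
      _ = Real.exp (Xs.card * -(β * ε₀ / 4)) := (Real.exp_nat_mul _ _).symm
      _ ≤ _ := Real.exp_le_exp.2 ?_
    have h4 := mul_le_mul_of_nonneg_right hn (by positivity : (0 : ℝ) ≤ β * ε₀ / 4)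
    have h5 : ε₀ / (4 * Fintype.card {q : Fin 4 × Fin 4 // q.1 < q.2}) * β * X.card =
        (X.card : ℝ) / Fintype.card {q : Fin 4 × Fin 4 // q.1 < q.2} * (β * ε₀ / 4) := by ring
    have h6 : (Xs.card : ℝ) * -(β * ε₀ / 4) = -((Xs.card : ℝ) * (β * ε₀ / 4)) := by ring
    rw [h5, h6]
    exact neg_le_neg h4
  exact hcheb.trans (ENNReal.ofReal_le_ofReal h3)

end Summit.QuantumFields.YangMills.Theorems.NonSimplyConnectedLatticeGap

end
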